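import Mathlib
import HarnessLib
import Summits.HubbardSuperconductivity.HubbardSuperconductivity.Theorems.KLProgrammeC4aUmkLoopCircleCanonicalMiddle
import Summits.HubbardSuperconductivity.HubbardSuperconductivity.Theorems.KLProgrammeC4aPPKernelMidSBumpBundle

/-!
# Route `KLProgramme` — crux C4a, S3 brick (B4) «(U1)-HYBRID», «SWAP-BY-SYMMETRY» kernel side part B3: U7-Middle ∘ `ppMidKernelSBump_lawRows`

Cell `gate-hubbard-kl`, seat hubbard-kl-k3c3-p1 (g19; row «δμ-flow with klAngularMean constant piece»).  SYMMETRIC ORGANISATION (pen (R529)(A), k3c3-p3 g38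
«SWAP-BY-SYMMETRY»: `U = 2U_A + U_M`): **`umkLoopCircle_integral_ppMidSBump_le_canonical`** = `umkLoopCircle_integral_middle_le_canonical` ∘ `ppMidKernelSBump_lawRows` — the umklapp law for the BUMPED comparable piece
`χ(u)·(M_s(e,u)/C)/Cχ`, zero kernel rows left.  Sequel: the `…Split` sibling (profile `ppSplitProfile t₁`, `C := Cᴹ(B₁,B₂,B₃,t₁)`; the bump `χ` stays abstract).
Pure real analysis on Literature objects; nothing asserts (C), K3, the window or superconductivity.
References: BGM 2006 §2.4 (2.36) [cite: BenfattoGiulianiMastropietro2006]; FST II CPAM 51 (1998) §3 [cite: FeldmanSalmhoferTrubowitz1998].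
-/

noncomputable section

namespace Summit.HubbardSuperconductivity.HubbardSuperconductivity.Theorems.C4a

set_option linter.dupNamespace false -- summit = problem name (single-conjunct summit), D-0017

open Real Set MeasureTheory intervalIntegral
open Literature.MathematicalPhysics.QuantumLattice Literature.MathematicalPhysics.QuantumLattice.BandSectorCounting
open Literature.MathematicalPhysics.QuantumLattice.FermiRG Literature.Analysis.SpecialFunctions
open Summit.HubbardSuperconductivity.HubbardSuperconductivity.Theorems.KLRegimeSplit
open Summit.HubbardSuperconductivity.HubbardSuperconductivity.Theorems.DispersionFlow
open Summit.HubbardSuperconductivity.HubbardSuperconductivity.Theorems.PerturbedFermiCurve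

section Sizes

variable {K : TrigPolyC4v} {A : ℝ} (hA : ∀ p : Momentum, ∀ j ≤ 2, ‖iteratedFDeriv ℝ j (frameShift K) p‖ ≤ A) (hA20 : A ≤ 1 / 20)
  (hd : klCurveD ≤ (bandBounds (show (-4 : ℝ) < -1.1 by norm_num) (show (-1.1 : ℝ) ≤ -0.1 by norm_num)
    (show (-0.1 : ℝ) < 0 by norm_num)).Dtmin - 2 * A)
  {μ r : ℝ} (hr : 0 < r) (hlo : (-1.1 : ℝ) < μ - r - A) (hhi : μ + r + A < -0.1)
  {A₃ A₄ : ℝ} (hA₃ : ∀ p : Momentum, ‖iteratedFDeriv ℝ 3 (frameShift K) p‖ ≤ A₃)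
  (hA₄ : ∀ p : Momentum, ‖iteratedFDeriv ℝ 4 (frameShift K) p‖ ≤ A₄)
  {K₁ K₂ K₃ : ℝ} (hK₁ : ∀ p : Momentum, ‖fderiv ℝ (frameLevel μ K) p‖ ≤ K₁) (hK₂ : ∀ p : Momentum, ‖iteratedFDeriv ℝ 2 (frameLevel μ K) p‖ ≤ K₂)
  (hK₃ : ∀ p : Momentum, ‖iteratedFDeriv ℝ 3 (frameLevel μ K) p‖ ≤ K₃)
include hA hA20 hd hr hlo hhi hA₃ hA₄ hK₁ hK₂ hK₃

set_option maxHeartbeats 400000 in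
/-- **THE UMKLAPP FIRST-ORDER ϑ-LAYER (COMPARABLE LEVELS) FOR THE BUMPED COMPARABLE PIECE** (stmt-20437 (C)/(U1), «SWAP-BY-SYMMETRY» re-key, pen (R529)(A)): k3c3-p3's `umkLoopCircle_integral_middle_le_canonical` at the BUMPED comparable piece
`Kr(e,u) := χ(u)·(ppMidKernelS βT Λ sκ lo e u / C)/Cχ`, `q_c := 2(2−t₁)/t₁`, `C_t := (C_t⁰/C + Bχ₁Rχ²/lo)/Cχ`, `Dfl := hi/t₁`, `ρm := (ρᴹ/C + Bχ₁Rχ²/s)/Cχ`, all fifteen kernel rows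
discharged by `ppMidKernelSBump_lawRows`.  What remains: the law's own rows verbatim, the kernel + bump DATA, `Afl ≥ (W·X_M)/Cχ`, `Bfl ≥ (4(2q′+3/2)(W′+W·Bχ₁) + W·Bχ₁·rχ⁻¹·hi)/Cχ`,
`Mρ ≥ (Mρᴹ/C + Bχ₁Rχ²hi²/lo³)/Cχ`, the weight's Lipschitz row on `[lo,hi]`, `hDfl : K₁·Δ ≤ hi/t₁`.
[cite: BenfattoGiulianiMastropietro2006, §2.4 (2.36)] [cite: FeldmanSalmhoferTrubowitz1998, §3] -/
theorem umkLoopCircle_integral_ppMidSBump_le_canonical {R : RenConsts} {U : ℝ} {N : ℕ} (hF : FrameOK R U N μ K) {Kc r₀ g₀ w : ℝ} (hG : GeomConstants (frameLevel μ K) Kc r₀ g₀ w)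
    {ρ : ℝ} (hρ : |ρ| < r) (hρ₀ : |ρ| < 3 / 80) (θ : ℝ) {Nt J : ℕ} (hJ : 2 ≤ J)
    {α₀ ℓ v₀ τ₀ lo hi Wφ Wm Δ K₀ Y₀ Y₁ YL W Afl Bfl Mρ Γ Γ' η₀ Δc ω d₁ lam eps κ₀ s₀ τ₁ s₁ : ℝ} {Y : ℝ → ℝ → ℝ → ℝ} {wt : ℝ → ℝ}
    {βT Λ B₁ B₂ B₃ : ℝ} (hkβ : 0 < βT) (hkΛ : 0 < Λ) (hkB₁ : ∀ x, |deriv salmhoferCutoff x| ≤ B₁) (hkB₂ : ∀ x, |deriv (deriv salmhoferCutoff) x| ≤ B₂)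
    (hkB₃ : ∀ x, |deriv (deriv (deriv salmhoferCutoff)) x| ≤ B₃)
    {sκ sκ' sκ'' : ℝ → ℝ} (hkκ : ∀ t, HasDerivAt sκ (sκ' t) t) (hkκ' : ∀ t, HasDerivAt sκ' (sκ'' t) t) (hkκ''c : Continuous sκ'')
    {sk₀ sk₁ sk₂ : ℝ} (hkκb : ∀ t ∈ Icc 0 1, |sκ t| ≤ sk₀) (hkκ'b : ∀ t ∈ Icc 0 1, |sκ' t| ≤ sk₁) (hkκ''b : ∀ t ∈ Icc 0 1, |sκ'' t| ≤ sk₂)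
    {t₁ : ℝ} (hkt₀ : 0 < t₁) (hkt25 : t₁ ≤ 2 / 5) (hkκs : ∀ t, t₁ ≤ t → sκ t = 0) (hkκ's : ∀ t, t₁ ≤ t → sκ' t = 0) (hkκ''s : ∀ t, t₁ ≤ t → sκ'' t = 0)
    (hkκ1 : ∀ t, t ≤ t₁ / 2 → sκ t = 1) (hkκ'1 : ∀ t, t ≤ t₁ / 2 → sκ' t = 0) (hkκ''1 : ∀ t, t ≤ t₁ / 2 → sκ'' t = 0)
    (hkloΛ : lo ≤ Λ) {C : ℝ} (hkC : 0 < C) (hkC0 : (1 + 2 * sk₀) * (12 * B₁ + 9) ≤ C)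
    (hkC1 : (1 + 2 * sk₀) * (128 * B₂ + 216 * B₁ + 294 + (48 * B₁ + 28) * ((2 - t₁) / t₁)) + 2 * sk₁ * (12 * B₁ + 9) ≤ C)
    (hkC2 : (1 + 2 * sk₀) * (512 * B₃ + 1664 * B₂ + 5280 * B₁ + 3424 + (256 * B₂ + 384 * B₁ + 504) * ((2 - t₁) / t₁) ^ 2 + (192 * B₁ + 112) * ((2 - t₁) / t₁)) +
          4 * sk₁ * (128 * B₂ + 216 * B₁ + 294 + (48 * B₁ + 28) * ((2 - t₁) / t₁)) +
          (12 * B₁ + 9) * (2 * sk₂ + 2 * sk₁ * ((2 - t₁) / t₁ + 2)) ≤ C)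
    (hkCs : (1 + 2 * sk₀) * (128 * B₁ + 72) + 16 * sk₁ ≤ C) {W' : ℝ} (hW' : 0 ≤ W') (hwL : ∀ e ∈ Icc lo hi, |wt e - wt lo| ≤ W' * (e - lo))
    {χ : ℝ → ℝ} (hbχ : ContDiff ℝ 2 χ) {Bχ₁ Bχ₂ rχ Rχ Cχ : ℝ} (hbχ0 : ∀ u, |χ u| ≤ 1) (hbχ1 : ∀ u, |deriv χ u| ≤ Bχ₁)
    (hbχ2 : ∀ u, |deriv (deriv χ) u| ≤ Bχ₂) (hbχ1r : ∀ u, |u| ≤ rχ → deriv χ u = 0) (hbrχ : 0 < rχ) (hbχ1z : ∀ u, Rχ ≤ |u| → deriv χ u = 0)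
    (hbχ2z : ∀ u, Rχ ≤ |u| → deriv (deriv χ) u = 0) (hbhiR : hi ≤ Rχ) (hbCχ : 1 + 2 * Bχ₁ * Rχ + Bχ₂ * Rχ ^ 2 ≤ Cχ)
    (hℓ : 0 ≤ ℓ) (hWm : 0 ≤ Wm) (hMρ : (((32 * ((1 + 2 * sk₀) * (64 * B₂ + 120 * B₁ + 154) + (2 * sk₁) * (12 * B₁ + 9)) * (Λ / lo) ^ 3 +
          32 * ((1 + 2 * sk₀) * ((βT * lo) ^ 2 + 2) + (2 * sk₁) * (βT * lo + 1)) / (βT * lo) ^ 3) / C) + Bχ₁ * (Rχ ^ 2 * hi ^ 2 / lo ^ 3)) / Cχ ≤ Mρ)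
    (hmod : K₃ * (τ₀ + msD A₃ A₄ 1 * (ℓ) +
              hi / ((bandBounds (show (-4 : ℝ) < -1.1 by norm_num) (show (-1.1 : ℝ) ≤ -0.1 by norm_num) (show (-0.1 : ℝ) < 0 by norm_num)).Dtmin - 2 * A) +
              msD A₃ A₄ 1 * Wφ) * msD A₃ A₄ 1 ^ 2 +
          K₂ * (radialRowOneConst A ((bandBounds (show (-4 : ℝ) < -1.1 by norm_num) (show (-1.1 : ℝ) ≤ -0.1 by norm_num) (show (-0.1 : ℝ) < 0 by norm_num)).Dtmin -
                2 * A) * hi + msD A₃ A₄ 2 * Wφ) * (msD A₃ A₄ 1 + msD A₃ A₄ 1) +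
          K₂ * (τ₀ + msD A₃ A₄ 1 * (ℓ) +
              hi / ((bandBounds (show (-4 : ℝ) < -1.1 by norm_num) (show (-1.1 : ℝ) ≤ -0.1 by norm_num) (show (-0.1 : ℝ) < 0 by norm_num)).Dtmin - 2 * A) +
              msD A₃ A₄ 1 * Wφ) * msD A₃ A₄ 2 +
          K₁ * ((uRowTwoConst A A₃ ((bandBounds (show (-4 : ℝ) < -1.1 by norm_num) (show (-1.1 : ℝ) ≤ -0.1 by norm_num) (show (-0.1 : ℝ) < 0 by norm_num)).Dtmin -
                  2 * A) +
                1 / ((bandBounds (show (-4 : ℝ) < -1.1 by norm_num) (show (-1.1 : ℝ) ≤ -0.1 by norm_num) (show (-0.1 : ℝ) < 0 by norm_num)).Dtmin - 2 * A) +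
                2 * (radialRowOneConst A ((bandBounds (show (-4 : ℝ) < -1.1 by norm_num) (show (-1.1 : ℝ) ≤ -0.1 by norm_num)
                    (show (-0.1 : ℝ) < 0 by norm_num)).Dtmin - 2 * A) -
                  1 / ((bandBounds (show (-4 : ℝ) < -1.1 by norm_num) (show (-1.1 : ℝ) ≤ -0.1 by norm_num) (show (-0.1 : ℝ) < 0 by norm_num)).Dtmin - 2 * A))) *
              hi + msD A₃ A₄ 3 * Wφ) ≤
        w * (bandBounds (show (-4 : ℝ) < -1.1 by norm_num) (show (-1.1 : ℝ) ≤ -0.1 by norm_num) (show (-0.1 : ℝ) < 0 by norm_num)).umin ^ 2)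
    (hsl : K₂ * msD A₃ A₄ 1 * (τ₀ + msD A₃ A₄ 1 * (ℓ) +
        2 * (hi / ((bandBounds (show (-4 : ℝ) < -1.1 by norm_num) (show (-1.1 : ℝ) ≤ -0.1 by norm_num) (show (-0.1 : ℝ) < 0 by norm_num)).Dtmin - 2 * A))) ≤
      w * (bandBounds (show (-4 : ℝ) < -1.1 by norm_num) (show (-1.1 : ℝ) ≤ -0.1 by norm_num) (show (-0.1 : ℝ) < 0 by norm_num)).umin ^ 2 * Wm)
    (hrt : K₂ * (τ₀ + msD A₃ A₄ 1 * (ℓ) +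
          2 * (hi / ((bandBounds (show (-4 : ℝ) < -1.1 by norm_num) (show (-1.1 : ℝ) ≤ -0.1 by norm_num) (show (-0.1 : ℝ) < 0 by norm_num)).Dtmin - 2 * A) +
            msD A₃ A₄ 1 * Wφ)) /
        ((bandBounds (show (-4 : ℝ) < -1.1 by norm_num) (show (-1.1 : ℝ) ≤ -0.1 by norm_num) (show (-0.1 : ℝ) < 0 by norm_num)).Dtmin - 2 * A) ≤ 1 / 2)
    (hlo0 : 0 < lo) (hlohi : lo ≤ hi) (hhir : hi < r) (hW : 0 ≤ W) (hAfl : (W * (65 + 32 * ((2 - t₁) / t₁) * (Λ + lo) / lo + (12 * (1 + 2 * sk₀) / βT + 4 * sk₁ * ((2 - t₁) / t₁) * lo + (1 + 2 * sk₀) * hi) / (C * lo))) / Cχ ≤ Afl)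
    (hBfl : ((4 * (2 * ((2 - t₁) / t₁) + 3 / 2) * (W' + W * Bχ₁)) + W * Bχ₁ * rχ⁻¹ * hi) / Cχ ≤ Bfl)
    (hK₀ : ∀ p : Momentum, |frameLevel μ K p| ≤ K₀) (hK₀pos : 0 < K₀) (hΓ₁ : K₀ ≤ Γ) (hΓ₂ : hi / 2 ≤ Γ) (hΓ'₁ : K₀ ≤ Γ')
    (hΔ : τ₀ + msD A₃ A₄ 1 * (ℓ) + 2 * (msD A₃ A₄ 1 * Wφ) ≤ Δ) (hΔ1 : Δ ≤ 3 / 10) (hΔu : Δ ≤ (bandBounds (show (-4 : ℝ) < -1.1 by norm_num) (show (-1.1 : ℝ) ≤ -0.1 by norm_num) (show (-0.1 : ℝ) < 0 by norm_num)).umin) (hΔr : K₁ * Δ < r) (hDfl : K₁ * Δ ≤ hi / t₁)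
    (hwc : ContinuousOn wt (Icc (-hi) hi)) (hw0 : ∀ e ∈ Icc (-hi) hi, 0 ≤ wt e) (hwW : ∀ e ∈ Icc (-hi) hi, wt e ≤ W)
    (hsame : τ₀ + 2 * (msD A₃ A₄ 1 * η₀ + |ρ| / ((bandBounds (show (-4 : ℝ) < -1.1 by norm_num) (show (-1.1 : ℝ) ≤ -0.1 by norm_num) (show (-0.1 : ℝ) < 0 by norm_num)).Dtmin - 2 * A)) ≤ 3 / 5)
    (hΔc1 : Δc ≤ 3 / 10) (hΔcr : K₁ * Δc < r) (hω₁ : η₀ + (ℓ) ≤ ω)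
    (hΓ : 2 / π * (((bandBounds (show (-4 : ℝ) < -1.1 by norm_num) (show (-1.1 : ℝ) ≤ -0.1 by norm_num) (show (-0.1 : ℝ) < 0 by norm_num)).Dtmin - 2 * A) * (bandBounds (show (-4 : ℝ) < -1.1 by norm_num) (show (-1.1 : ℝ) ≤ -0.1 by norm_num) (show (-0.1 : ℝ) < 0 by norm_num)).umin) *
      ((bandBounds (show (-4 : ℝ) < -1.1 by norm_num) (show (-1.1 : ℝ) ≤ -0.1 by norm_num) (show (-0.1 : ℝ) < 0 by norm_num)).umin * (3 / 200) / (4 + 2 * A) * (η₀ - (ℓ) - π / (2 * (bandBounds (show (-4 : ℝ) < -1.1 by norm_num) (show (-1.1 : ℝ) ≤ -0.1 by norm_num) (show (-0.1 : ℝ) < 0 by norm_num)).umin) * Δc) - π * 7 * (K₁ * Δc + |ρ|) / ((bandBounds (show (-4 : ℝ) < -1.1 by norm_num) (show (-1.1 : ℝ) ≤ -0.1 by norm_num) (show (-0.1 : ℝ) < 0 by norm_num)).Dtmin - 2 * A) ^ 2) * (ℓ) ≤ Γ)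
    (hhir₀ : hi < r₀) (hhiK : hi ≤ K₀) (hd₁ : 0 < d₁) (hlam : 0 < lam)
    (hhid : K₁ * (hi / ((bandBounds (show (-4 : ℝ) < -1.1 by norm_num) (show (-1.1 : ℝ) ≤ -0.1 by norm_num) (show (-0.1 : ℝ) < 0 by norm_num)).Dtmin - 2 * A)) ≤ d₁ / 2)
    (hepsr : eps ≤ r)
    (hT : KlwjCertB)
    (hτ₀ : msD A₃ A₄ 1 *
            ((π / 2 * lam /
                  (((bandBounds (show (-4 : ℝ) < -1.1 by norm_num) (show (-1.1 : ℝ) ≤ -0.1 by norm_num) (show (-0.1 : ℝ) < 0 by norm_num)).Dtmin -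
                      2 * A) *
                    (bandBounds (show (-4 : ℝ) < -1.1 by norm_num) (show (-1.1 : ℝ) ≤ -0.1 by norm_num) (show (-0.1 : ℝ) < 0 by norm_num)).umin) +
                π * Kc * eps / ((bandBounds (show (-4 : ℝ) < -1.1 by norm_num) (show (-1.1 : ℝ) ≤ -0.1 by norm_num) (show (-0.1 : ℝ) < 0 by norm_num)).Dtmin - 2 * A) ^ 2) /
              ((bandBounds (show (-4 : ℝ) < -1.1 by norm_num) (show (-1.1 : ℝ) ≤ -0.1 by norm_num) (show (-0.1 : ℝ) < 0 by norm_num)).umin * w /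
                (4 + 2 * A))) +
          (2 * hi + eps) / ((bandBounds (show (-4 : ℝ) < -1.1 by norm_num) (show (-1.1 : ℝ) ≤ -0.1 by norm_num) (show (-0.1 : ℝ) < 0 by norm_num)).Dtmin -
            2 * A) ≤ τ₀)
    (hκ₀ : 0 < κ₀) (hκ₀le : κ₀ ≤ 2 / π * (((bandBounds (show (-4 : ℝ) < -1.1 by norm_num) (show (-1.1 : ℝ) ≤ -0.1 by norm_num) (show (-0.1 : ℝ) < 0 by norm_num)).Dtmin - 2 * A) * (bandBounds (show (-4 : ℝ) < -1.1 by norm_num) (show (-1.1 : ℝ) ≤ -0.1 by norm_num) (show (-0.1 : ℝ) < 0 by norm_num)).umin) *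
      ((bandBounds (show (-4 : ℝ) < -1.1 by norm_num) (show (-1.1 : ℝ) ≤ -0.1 by norm_num) (show (-0.1 : ℝ) < 0 by norm_num)).umin * (3 / 200) / (4 + 2 * A) * (η₀ - (ℓ) - π / (2 * (bandBounds (show (-4 : ℝ) < -1.1 by norm_num) (show (-1.1 : ℝ) ≤ -0.1 by norm_num) (show (-0.1 : ℝ) < 0 by norm_num)).umin) * Δc) - π * 7 * (K₁ * Δc + |ρ|) / ((bandBounds (show (-4 : ℝ) < -1.1 by norm_num) (show (-1.1 : ℝ) ≤ -0.1 by norm_num) (show (-0.1 : ℝ) < 0 by norm_num)).Dtmin - 2 * A) ^ 2))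
    (hs₀ : 0 < s₀) (hs₀le : s₀ ≤ 9 / 400 * (bandBounds (show (-4 : ℝ) < -1.1 by norm_num) (show (-1.1 : ℝ) ≤ -0.1 by norm_num) (show (-0.1 : ℝ) < 0 by norm_num)).umin ^ 2 - 2 * (2 * K₃ * Δc * msD A₃ A₄ 1 ^ 2 +
        4 * K₂ * (radialRowOneConst A ((bandBounds (show (-4 : ℝ) < -1.1 by norm_num) (show (-1.1 : ℝ) ≤ -0.1 by norm_num) (show (-0.1 : ℝ) < 0 by norm_num)).Dtmin - 2 * A) * |ρ| + msD A₃ A₄ 2 * ω) * msD A₃ A₄ 1 +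
        K₂ * Δc * msD A₃ A₄ 2 +
        K₁ * ((uRowTwoConst A A₃ ((bandBounds (show (-4 : ℝ) < -1.1 by norm_num) (show (-1.1 : ℝ) ≤ -0.1 by norm_num) (show (-0.1 : ℝ) < 0 by norm_num)).Dtmin - 2 * A) + 1 / ((bandBounds (show (-4 : ℝ) < -1.1 by norm_num) (show (-1.1 : ℝ) ≤ -0.1 by norm_num) (show (-0.1 : ℝ) < 0 by norm_num)).Dtmin - 2 * A) +
              2 * (radialRowOneConst A ((bandBounds (show (-4 : ℝ) < -1.1 by norm_num) (show (-1.1 : ℝ) ≤ -0.1 by norm_num) (show (-0.1 : ℝ) < 0 by norm_num)).Dtmin - 2 * A) - 1 / ((bandBounds (show (-4 : ℝ) < -1.1 by norm_num) (show (-1.1 : ℝ) ≤ -0.1 by norm_num) (show (-0.1 : ℝ) < 0 by norm_num)).Dtmin - 2 * A))) * |ρ| + msD A₃ A₄ 3 * ω)))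
    (hτ₁ : τ₀ + msD A₃ A₄ 1 * (ℓ + 2 * (4 * (2 * π / J))) ≤ τ₁)
    (hYnull : ∀ ϑ ∈ Icc α₀ (α₀ + Nt * ℓ), ∀ e ∈ Icc (-hi) hi, ∀ v, ‖pairSumPath μ K ρ ϑ θ 0 - (2 : ℝ) • levelPoint μ K 0 (v + θ)‖ ≤ τ₁ → Y ϑ e v = 0)
    (hs₁ : msD A₃ A₄ 1 *
            ((π / 2 * lam /
                  (((bandBounds (show (-4 : ℝ) < -1.1 by norm_num) (show (-1.1 : ℝ) ≤ -0.1 by norm_num) (show (-0.1 : ℝ) < 0 by norm_num)).Dtmin -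
                      2 * A) *
                    (bandBounds (show (-4 : ℝ) < -1.1 by norm_num) (show (-1.1 : ℝ) ≤ -0.1 by norm_num) (show (-0.1 : ℝ) < 0 by norm_num)).umin) +
                π * Kc * eps / ((bandBounds (show (-4 : ℝ) < -1.1 by norm_num) (show (-1.1 : ℝ) ≤ -0.1 by norm_num) (show (-0.1 : ℝ) < 0 by norm_num)).Dtmin - 2 * A) ^ 2) /
              ((bandBounds (show (-4 : ℝ) < -1.1 by norm_num) (show (-1.1 : ℝ) ≤ -0.1 by norm_num) (show (-0.1 : ℝ) < 0 by norm_num)).umin * w /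
                (4 + 2 * A))) +
          eps / ((bandBounds (show (-4 : ℝ) < -1.1 by norm_num) (show (-1.1 : ℝ) ≤ -0.1 by norm_num) (show (-0.1 : ℝ) < 0 by norm_num)).Dtmin - 2 * A) + msD A₃ A₄ 1 * ℓ ≤ s₁)
    (hCnull : ∀ ϑ ∈ Icc α₀ (α₀ + Nt * ℓ), ∀ e ∈ Icc (-hi) hi, ∀ v, ‖pairSumPath μ K ρ ϑ θ 0‖ ≤ s₁ → Y ϑ e v = 0)
    (hWφ : (4 * (2 * π / J)) + 2 * Wm ≤ Wφ) (hΓ'₂ : w * (bandBounds (show (-4 : ℝ) < -1.1 by norm_num) (show (-1.1 : ℝ) ≤ -0.1 by norm_num) (show (-0.1 : ℝ) < 0 by norm_num)).umin ^ 2 / 2 * ((4 * (2 * π / J)) + 2 * Wm) ^ 2 ≤ Γ')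
    (hΔc : τ₀ + msD A₃ A₄ 1 * ((ℓ) + ((4 * (2 * π / J)) + 2 * Wm)) ≤ Δc) (hω₂ : (4 * (2 * π / J)) + 2 * Wm ≤ ω)
    (heps : d₁ + K₁ * (msD A₃ A₄ 1 * ((4 * (2 * π / J)))) + K₁ * (hi / ((bandBounds (show (-4 : ℝ) < -1.1 by norm_num) (show (-1.1 : ℝ) ≤ -0.1 by norm_num) (show (-0.1 : ℝ) < 0 by norm_num)).Dtmin - 2 * A)) + hi ≤ eps)
   
   
    (hY₀ : 0 ≤ Y₀) (hY₁ : 0 ≤ Y₁) (hYL : 0 ≤ YL) (hYd : ∀ ϑ, ∀ e ∈ Icc (-hi) hi, ContDiff ℝ 1 (Y ϑ e))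
    (hY3 : ContinuousOn (fun p : ℝ × ℝ × ℝ => Y p.1 p.2.1 p.2.2) (univ ×ˢ (Icc (-hi) hi ×ˢ univ)))
    (hYb : ∀ ϑ, ∀ e ∈ Icc (-hi) hi, ∀ v, |Y ϑ e v| ≤ Y₀) (hY1 : ∀ ϑ, ∀ e ∈ Icc (-hi) hi, ∀ v, |deriv (Y ϑ e) v| ≤ Y₁)
    (hYLip : ∀ ϑ, ∀ e ∈ Icc lo hi, ∀ v, |Y ϑ e v - Y ϑ lo v| ≤ YL * |e - lo|) (hYper : ∀ ϑ, ∀ e ∈ Icc (-hi) hi, ∀ v, Y ϑ e (v + 2 * π) = Y ϑ e v) :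
    ∫ ϑ in α₀..(α₀ + Nt * ℓ), |∫ e in (-hi)..hi, ∫ v in v₀..(v₀ + 2 * π), wt e * (Y ϑ e v * deriv (fun v : ℝ => χ v * (ppMidKernelS βT Λ sκ lo e v / C) / Cχ) (frameLevel μ K (pairSumPath μ K ρ ϑ θ 0 - levelPoint μ K e (v + θ))))| ≤ (J : ℝ) * ((Nt : ℝ) * max (max (2 * ((2 * (      3 * W * ((4 + 2 * (3 / 2 : ℝ) + 1 / 2) / (1 / 2)) *
          (Y₀ * (4 / Real.sqrt (2 * (K₂ * msD A₃ A₄ 1 ^ 2) +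
                    w * (bandBounds (show (-4 : ℝ) < -1.1 by norm_num) (show (-1.1 : ℝ) ≤ -0.1 by norm_num) (show (-0.1 : ℝ) < 0 by norm_num)).umin ^ 2) +
                  16 * Real.sqrt (2 * (K₂ * msD A₃ A₄ 1 ^ 2) +
                        w * (bandBounds (show (-4 : ℝ) < -1.1 by norm_num) (show (-1.1 : ℝ) ≤ -0.1 by norm_num) (show (-0.1 : ℝ) < 0 by norm_num)).umin ^ 2) /
                      (w * (bandBounds (show (-4 : ℝ) < -1.1 by norm_num) (show (-1.1 : ℝ) ≤ -0.1 by norm_num) (show (-0.1 : ℝ) < 0 by norm_num)).umin ^ 2) +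
                  64 * (2 * (K₂ * msD A₃ A₄ 1 ^ 2) +
                          w * (bandBounds (show (-4 : ℝ) < -1.1 by norm_num) (show (-1.1 : ℝ) ≤ -0.1 by norm_num) (show (-0.1 : ℝ) < 0 by norm_num)).umin ^ 2) ^ 2 *
                      Real.sqrt (2 * (K₂ * msD A₃ A₄ 1 ^ 2) +
                          w * (bandBounds (show (-4 : ℝ) < -1.1 by norm_num) (show (-1.1 : ℝ) ≤ -0.1 by norm_num) (show (-0.1 : ℝ) < 0 by norm_num)).umin ^ 2) /
                    (w * (bandBounds (show (-4 : ℝ) < -1.1 by norm_num) (show (-1.1 : ℝ) ≤ -0.1 by norm_num) (show (-0.1 : ℝ) < 0 by norm_num)).umin ^ 2) ^ 3) *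
              Real.sqrt (4 + 2 * (3 / 2 : ℝ) + 1 / 2) +
            32 * (Y₁ + Y₀ * (6 / (2 * π / J))) * (2 * (K₂ * msD A₃ A₄ 1 ^ 2) +
                  w * (bandBounds (show (-4 : ℝ) < -1.1 by norm_num) (show (-1.1 : ℝ) ≤ -0.1 by norm_num) (show (-0.1 : ℝ) < 0 by norm_num)).umin ^ 2) /
              (w * (bandBounds (show (-4 : ℝ) < -1.1 by norm_num) (show (-1.1 : ℝ) ≤ -0.1 by norm_num) (show (-0.1 : ℝ) < 0 by norm_num)).umin ^ 2) ^ 2))) * max 1 (Real.sqrt (κ₀))⁻¹ * (81 * (Γ / (κ₀)) ^ (1 / 4 : ℝ)) *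
          ((ℓ) ^ (3 / 4 : ℝ) / (3 / 4) + (ℓ) ^ (1 / 4 : ℝ) / (1 / 4))))
      ((8 * (32 * (Y₀ * Afl + W * Y₀ * ((((8 * ((2 - t₁) / t₁) * (Λ / lo) * ((1 + 2 * sk₀) * (128 * B₂ + 216 * B₁ + 294 + (48 * B₁ + 28) * ((2 - t₁) / t₁)) + 2 * sk₁ * (12 * B₁ + 9)) +
          ((1 + 2 * sk₀) * (48 * ((2 - t₁) / t₁) ^ 3) + 16 * sk₁ * ((2 - t₁) / t₁) ^ 2) / (βT * lo)) / C) + Bχ₁ * Rχ * (Rχ / lo)) / Cχ) + 5 * (W * Y₀ * Mρ) + 32 * (W * Y₀)) / (3 * Real.sqrt (w * (bandBounds (show (-4 : ℝ) < -1.1 by norm_num) (show (-1.1 : ℝ) ≤ -0.1 by norm_num) (show (-0.1 : ℝ) < 0 by norm_num)).umin ^ 2 / 2))) + 4 * (2 * (      W * (Y₀ * (4 / Real.sqrt (2 * (K₂ * msD A₃ A₄ 1 ^ 2) +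
                    w * (bandBounds (show (-4 : ℝ) < -1.1 by norm_num) (show (-1.1 : ℝ) ≤ -0.1 by norm_num) (show (-0.1 : ℝ) < 0 by norm_num)).umin ^ 2) + 16 * Real.sqrt (2 * (K₂ * msD A₃ A₄ 1 ^ 2) +
                    w * (bandBounds (show (-4 : ℝ) < -1.1 by norm_num) (show (-1.1 : ℝ) ≤ -0.1 by norm_num) (show (-0.1 : ℝ) < 0 by norm_num)).umin ^ 2) / (w * (bandBounds (show (-4 : ℝ) < -1.1 by norm_num) (show (-1.1 : ℝ) ≤ -0.1 by norm_num) (show (-0.1 : ℝ) < 0 by norm_num)).umin ^ 2) + 64 * (2 * (K₂ * msD A₃ A₄ 1 ^ 2) +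
                    w * (bandBounds (show (-4 : ℝ) < -1.1 by norm_num) (show (-1.1 : ℝ) ≤ -0.1 by norm_num) (show (-0.1 : ℝ) < 0 by norm_num)).umin ^ 2) ^ 2 * Real.sqrt (2 * (K₂ * msD A₃ A₄ 1 ^ 2) +
                    w * (bandBounds (show (-4 : ℝ) < -1.1 by norm_num) (show (-1.1 : ℝ) ≤ -0.1 by norm_num) (show (-0.1 : ℝ) < 0 by norm_num)).umin ^ 2) / (w * (bandBounds (show (-4 : ℝ) < -1.1 by norm_num) (show (-1.1 : ℝ) ≤ -0.1 by norm_num) (show (-0.1 : ℝ) < 0 by norm_num)).umin ^ 2) ^ 3 +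
              2 * Real.sqrt (w * (bandBounds (show (-4 : ℝ) < -1.1 by norm_num) (show (-1.1 : ℝ) ≤ -0.1 by norm_num) (show (-0.1 : ℝ) < 0 by norm_num)).umin ^ 2) / (w * (bandBounds (show (-4 : ℝ) < -1.1 by norm_num) (show (-1.1 : ℝ) ≤ -0.1 by norm_num) (show (-0.1 : ℝ) < 0 by norm_num)).umin ^ 2) + (2 * (K₂ * msD A₃ A₄ 1 ^ 2) +
                    w * (bandBounds (show (-4 : ℝ) < -1.1 by norm_num) (show (-1.1 : ℝ) ≤ -0.1 by norm_num) (show (-0.1 : ℝ) < 0 by norm_num)).umin ^ 2) * Real.sqrt (w * (bandBounds (show (-4 : ℝ) < -1.1 by norm_num) (show (-1.1 : ℝ) ≤ -0.1 by norm_num) (show (-0.1 : ℝ) < 0 by norm_num)).umin ^ 2) / (w * (bandBounds (show (-4 : ℝ) < -1.1 by norm_num) (show (-1.1 : ℝ) ≤ -0.1 by norm_num) (show (-0.1 : ℝ) < 0 by norm_num)).umin ^ 2) ^ 2) +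
            (Y₁ + Y₀ * (6 / (2 * π / J))) * (32 * (2 * (K₂ * msD A₃ A₄ 1 ^ 2) +
                    w * (bandBounds (show (-4 : ℝ) < -1.1 by norm_num) (show (-1.1 : ℝ) ≤ -0.1 by norm_num) (show (-0.1 : ℝ) < 0 by norm_num)).umin ^ 2) * Real.sqrt (K₀ + hi) / (w * (bandBounds (show (-4 : ℝ) < -1.1 by norm_num) (show (-1.1 : ℝ) ≤ -0.1 by norm_num) (show (-0.1 : ℝ) < 0 by norm_num)).umin ^ 2) ^ 2 + ((4 * (2 * π / J)) + 2 * Wm) * Real.sqrt (w * (bandBounds (show (-4 : ℝ) < -1.1 by norm_num) (show (-1.1 : ℝ) ≤ -0.1 by norm_num) (show (-0.1 : ℝ) < 0 by norm_num)).umin ^ 2) / (w * (bandBounds (show (-4 : ℝ) < -1.1 by norm_num) (show (-1.1 : ℝ) ≤ -0.1 by norm_num) (show (-0.1 : ℝ) < 0 by norm_num)).umin ^ 2))) *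
          ((4 + 2 * (3 / 2 : ℝ) + 1 / 2) * Real.sqrt (4 + 2 * (3 / 2 : ℝ) + 1 / 2) *
                ((1 + Real.log 2 + log⁺ ((1 + 4 * (2 * (K₂ * msD A₃ A₄ 1 ^ 2) +
                    w * (bandBounds (show (-4 : ℝ) < -1.1 by norm_num) (show (-1.1 : ℝ) ≤ -0.1 by norm_num) (show (-0.1 : ℝ) < 0 by norm_num)).umin ^ 2) / (w * (bandBounds (show (-4 : ℝ) < -1.1 by norm_num) (show (-1.1 : ℝ) ≤ -0.1 by norm_num) (show (-0.1 : ℝ) < 0 by norm_num)).umin ^ 2)) * (1 + (3 / 2 : ℝ))) + log⁺ (1 + 4 * (2 * (K₂ * msD A₃ A₄ 1 ^ 2) +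
                    w * (bandBounds (show (-4 : ℝ) < -1.1 by norm_num) (show (-1.1 : ℝ) ≤ -0.1 by norm_num) (show (-0.1 : ℝ) < 0 by norm_num)).umin ^ 2) / (w * (bandBounds (show (-4 : ℝ) < -1.1 by norm_num) (show (-1.1 : ℝ) ≤ -0.1 by norm_num) (show (-0.1 : ℝ) < 0 by norm_num)).umin ^ 2))) + 4) +
            2 * (1 + Real.log 2 + log⁺ ((1 + 4 * (2 * (K₂ * msD A₃ A₄ 1 ^ 2) +
                    w * (bandBounds (show (-4 : ℝ) < -1.1 by norm_num) (show (-1.1 : ℝ) ≤ -0.1 by norm_num) (show (-0.1 : ℝ) < 0 by norm_num)).umin ^ 2) / (w * (bandBounds (show (-4 : ℝ) < -1.1 by norm_num) (show (-1.1 : ℝ) ≤ -0.1 by norm_num) (show (-0.1 : ℝ) < 0 by norm_num)).umin ^ 2)) * (1 + (3 / 2 : ℝ))) + log⁺ (1 + 4 * (2 * (K₂ * msD A₃ A₄ 1 ^ 2) +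
                    w * (bandBounds (show (-4 : ℝ) < -1.1 by norm_num) (show (-1.1 : ℝ) ≤ -0.1 by norm_num) (show (-0.1 : ℝ) < 0 by norm_num)).umin ^ 2) / (w * (bandBounds (show (-4 : ℝ) < -1.1 by norm_num) (show (-1.1 : ℝ) ≤ -0.1 by norm_num) (show (-0.1 : ℝ) < 0 by norm_num)).umin ^ 2))) *
              ((4 + 2 * (3 / 2 : ℝ) + 1 / 2) / (1 / 2) * Real.sqrt ((4 + 2 * (3 / 2 : ℝ) + 1 / 2) / (1 / 2))))))) / Real.sqrt ((s₀) / 2) + (((16 * ((2 * ((2 - t₁) / t₁)) + 3 / 2) ^ 3 * W * Y₀ * (K₂ / ((bandBounds (show (-4 : ℝ) < -1.1 by norm_num) (show (-1.1 : ℝ) ≤ -0.1 by norm_num) (show (-0.1 : ℝ) < 0 by norm_num)).Dtmin - 2 * A)) * (1 / ((bandBounds (show (-4 : ℝ) < -1.1 by norm_num) (show (-1.1 : ℝ) ≤ -0.1 by norm_num) (show (-0.1 : ℝ) < 0 by norm_num)).Dtmin - 2 * A) + msD A₃ A₄ 1 * (π * (4 + 2 * A) * Kc / ((bandBounds (show (-4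 : ℝ) < -1.1 by norm_num) (show (-1.1 : ℝ) ≤ -0.1 by norm_num) (show (-0.1 : ℝ) < 0 by norm_num)).umin * w * ((bandBounds (show (-4 : ℝ) < -1.1 by norm_num) (show (-1.1 : ℝ) ≤ -0.1 by norm_num) (show (-0.1 : ℝ) < 0 by norm_num)).Dtmin - 2 * A) ^ 2))) + 128 * ((2 * ((2 - t₁) / t₁)) + 3 / 2) ^ 3 * W * Y₀ * (K₂ / ((bandBounds (show (-4 : ℝ) < -1.1 by norm_num) (show (-1.1 : ℝ) ≤ -0.1 by norm_num) (show (-0.1 : ℝ) < 0 by norm_num)).Dtmin - 2 * A) ^ 2) + 16 * ((2 * ((2 - t₁) / t₁)) + 3 / 2) ^ 2 * W * YL + Y₀ * Bfl) * ((4 * (2 * π / J)) + 2 * Wm) +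
          8 * (32 * ((2 * ((2 - t₁) / t₁)) + 3 / 2) ^ 3 * W * Y₀ * (K₂ / ((bandBounds (show (-4 : ℝ) < -1.1 by norm_num) (show (-1.1 : ℝ) ≤ -0.1 by norm_num) (show (-0.1 : ℝ) < 0 by norm_num)).Dtmin - 2 * A)) * msD A₃ A₄ 1) /
            (w * (bandBounds (show (-4 : ℝ) < -1.1 by norm_num) (show (-1.1 : ℝ) ≤ -0.1 by norm_num) (show (-0.1 : ℝ) < 0 by norm_num)).umin ^ 2 / 2) * Real.log 2)) * (ℓ) +
        (4 * (32 * ((2 * ((2 - t₁) / t₁)) + 3 / 2) ^ 3 * W * Y₀ * (K₂ / ((bandBounds (show (-4 : ℝ) < -1.1 by norm_num) (show (-1.1 : ℝ) ≤ -0.1 by norm_num) (show (-0.1 : ℝ) < 0 by norm_num)).Dtmin - 2 * A)) * msD A₃ A₄ 1) /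
          (w * (bandBounds (show (-4 : ℝ) < -1.1 by norm_num) (show (-1.1 : ℝ) ≤ -0.1 by norm_num) (show (-0.1 : ℝ) < 0 by norm_num)).umin ^ 2 / 2)) * (2 * (Γ' / ((s₀) / 2)) ^ (1 / 4 : ℝ)) * (8 * Real.sqrt (ℓ))))
      (ℓ * max (2 * hi * (((4 * (2 * π / J))) * (W * Y₀ * (4 / d₁ ^ 2))))
        (W * ((Y₀ * ((K₂ * msD A₃ A₄ 1 ^ 2 + K₁ * msD A₃ A₄ 2) / lam ^ 2) + (Y₁ + Y₀ * (6 / (2 * π / J))) * lam⁻¹) * (lam⁻¹ * (4 * Real.sqrt K₀))) * (4 * Real.sqrt hi)))) := by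
  have hB10 : 0 ≤ B₁ := salmhoferB₁_nonneg hkB₁
  have hB20 : 0 ≤ B₂ := salmhoferB₂_nonneg hkB₂
  have hsk₀0 : 0 ≤ sk₀ := (abs_nonneg _).trans (hkκb 0 (left_mem_Icc.2 zero_le_one))
  have hsk₁0 : 0 ≤ sk₁ := (abs_nonneg _).trans (hkκ'b 0 (left_mem_Icc.2 zero_le_one))
  have hhi0 : 0 < hi := hlo0.trans_le hlohi
  have hBχ1 : 0 ≤ Bχ₁ := (abs_nonneg _).trans (hbχ1 0)
  have hCχ1 : 1 ≤ Cχ := bumpNormalisation_one_le hbχ1 hbχ2 hlo0 hlohi hbhiR hbCχ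
  have hCχ0 : 0 < Cχ := by linarith
  have hRχ0 : 0 < Rχ := hlo0.trans_le (hlohi.trans hbhiR)
  obtain ⟨hqc, hCt0, hAflle, hBflle, hMρle⟩ := ppMidKernelS_lawConsts (hi := hi) hkβ hkΛ hkB₁ hkB₂ hkκb hkκ'b hkt₀ hkt25 hlo0 hkC hW hW' hhi0
  have hCt : 0 ≤ ((((8 * ((2 - t₁) / t₁) * (Λ / lo) * ((1 + 2 * sk₀) * (128 * B₂ + 216 * B₁ + 294 + (48 * B₁ + 28) * ((2 - t₁) / t₁)) + 2 * sk₁ * (12 * B₁ + 9)) +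
          ((1 + 2 * sk₀) * (48 * ((2 - t₁) / t₁) ^ 3) + 16 * sk₁ * ((2 - t₁) / t₁) ^ 2) / (βT * lo)) / C) + Bχ₁ * Rχ * (Rχ / lo)) / Cχ) := by positivity
  have hMρ0 : 0 ≤ Mρ := le_trans (by positivity) hMρ
  have hAfl0 : 0 ≤ Afl := le_trans (div_nonneg hAflle hCχ0.le) hAfl
  have hBfl0 : 0 ≤ Bfl := le_trans (by positivity) hBfl
  obtain ⟨rKd, rK2d, rK0, rK0s, rK1, rK2, rcomp, rKopp, rKc, rflatB, rKn1, rρ0, rρc, rρtail, rKs1⟩ :=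
    ppMidKernelSBump_lawRows (hi := hi) hkβ hkΛ hkB₁ hkB₂ hkB₃ hkκ hkκ' hkκ''c hkκb hkκ'b hkκ''b hkt₀ hkt25 hkκs hkκ's hkκ''s hkκ1 hkκ'1 hkκ''1 hlo0 hkloΛ hkC
      hbχ hbχ0 hbχ1 hbχ2 hbχ1r hbrχ hbχ1z hbχ2z hbhiR hbCχ hkC0 hkC1 hkC2 hkCs hlohi hwc hw0 hwW hW' hwL
  exact umkLoopCircle_integral_middle_le_canonical hA hA20 hd hr hlo hhi hA₃ hA₄ hK₁ hK₂ hK₃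
    (Kr := fun e u => χ u * (ppMidKernelS βT Λ sκ lo e u / C) / Cχ) (qc := (2 * ((2 - t₁) / t₁))) (Dfl := hi / t₁)
    (Ct := ((((8 * ((2 - t₁) / t₁) * (Λ / lo) * ((1 + 2 * sk₀) * (128 * B₂ + 216 * B₁ + 294 + (48 * B₁ + 28) * ((2 - t₁) / t₁)) + 2 * sk₁ * (12 * B₁ + 9)) +
          ((1 + 2 * sk₀) * (48 * ((2 - t₁) / t₁) ^ 3) + 16 * sk₁ * ((2 - t₁) / t₁) ^ 2) / (βT * lo)) / C) + Bχ₁ * Rχ * (Rχ / lo)) / Cχ))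
    (ρm := fun s : ℝ => (((64 * ((1 + 2 * sk₀) * (64 * B₂ + 120 * B₁ + 154) + (2 * sk₁) * (12 * B₁ + 9)) * Λ ^ 3 / (s + 2 * Λ) ^ 3 +
          ((1 + 2 * sk₀) * ((βT * lo) ^ 2 + 2) + (2 * sk₁) * (βT * lo + 1)) * Real.exp (-(βT / 2 * s))) / C) + Bχ₁ * (Rχ ^ 2 / s)) / Cχ)
    hF
    hG
    hρ
    hρ₀
    θ
    hJ
    hℓ
    hWm
    hMρ0
    hmod
    hsl
    hrt
    hlo0
    hlohi
    hhir
    hqc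
    hCt
    hW
    hAfl0
    hBfl0
    hK₀
    hK₀pos
    hΓ₁
    hΓ₂
    hΓ'₁
    hΔ
    hΔ1
    hΔu
    hΔr
    hDfl
    rKd
    rK2d
    rK0
    rK0s
    rK1
    rK2
    rcomp
    rKopp
    rKc
    (fun D hD hDle => (rflatB D hD hDle).trans (add_le_add (mul_le_mul_of_nonneg_right hAfl (by positivity)) hBfl))
    rKn1
    rρ0
    rρc
    (fun a ha => (rρtail a ha).trans (mul_le_mul_of_nonneg_right hMρ (by have := ha.1; positivity)))
    rKs1
    hwc
    hw0
    hwW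
    hsame
    hΔc1
    hΔcr
    hω₁
    hΓ
    hhir₀
    hhiK
    hd₁
    hlam
    hhid
    hepsr
    hT
    hτ₀
    hκ₀
    hκ₀le
    hs₀
    hs₀le
    hτ₁
    hYnull
    hs₁
    hCnull
    hWφ
    hΓ'₂
    hΔc
    hω₂
    heps
    hY₀
    hY₁
    hYL
    hYd
    hY3
    hYb
    hY1
    hYLip
    hYper

end Sizes

end Summit.HubbardSuperconductivity.HubbardSuperconductivity.Theorems.C4a

end
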